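import Summits.CriticalPhenomena.Ising3DConformalLimit.Theorems.RotationUpgradeFromTwoPoint.Negative.AutomaticOrders
import Literature.Probability.LatticeModels.CriticalUrsellFourSign
import Literature.Probability.LatticeModels.CriticalCorrWellDefined
import Literature.Probability.LatticeModels.GKSInequalities

/-!
# `RotationUpgradeFromTwoPoint` (item stmt-CriticalPhenomena-8367): the non-degeneracy hypothesis (H4) is NOT load-bearing

Structural knowledge about the crux
`Summit.CriticalPhenomena.Ising3DConformalLimit.Theses.GaussianScaleMixture.RotationUpgradeFromTwoPoint`
(standing crux disprover, D-0016, cycle 1; THEOREM-ONLY). Hypotheses (H1)–(H7) as in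
`Negative/AutomaticOrders.lean`.

**`crux_iff_withoutNondegeneracy`**: the crux is EQUIVALENT to its version with (H4)
`IsNondegenerateTwoPoint S` deleted. Reason (`isRotationInvariant_of_degenerate`): a DEGENERATE
instance — `S₂ ≤ 0` at one non-coincident pair — is identically trivial, `S = (1, 0, 0, 0, …)`:
`S₂ ≥ 0` on non-coincident pairs (Griffiths I passes to the limit, `limit_nonneg`), so `S₂ = 0` at
that pair; (H5)+(H6)+(H7) transport the zero to every pair (`two_eq_zero_of_degenerate`: translate,
dilate, rotate with `Submodule.reflection_sub`); then `0 ≤ S₄ ≤ Σ S₂S₂ = 0` on non-coincident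
quadruples (Griffiths I and the limit form of Lebowitz' inequality, tree
`limitConnectedFour_nonpos_of_hasPointwiseScalingLimit`), so `U₄ ≡ 0` and the Aizenman–Newman
dichotomy (tree `HasPointwiseScalingLimit.eq_pairingSum_of_limitConnectedFour_eq_zero`) kills every
even order `≥ 4`; odd orders vanish anyway. A family that is `0` at every order `n ≥ 1` is rotation
invariant. So (H4) only serves to exclude the junk renormalisations `ρ`, none of which endangers
the conclusion: with `Negative/AutomaticOrders.lean` (`crux_iff_core`) the crux is
"(H1)+(H2)+(H3)+(H7) ⇒ rotation invariance" up to the automatic scale covariance, and its whole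
content is carried by the lattice clause (H2), the normalisation (H3) and two-point isotropy (H7).
-/

noncomputable section

namespace Summit.CriticalPhenomena.Ising3DConformalLimit.RotationUpgradeFromTwoPointNegative

open Literature.Probability.LatticeModels Literature.Barriers.CriticalPhenomena
open Filter Set Function ScaleNotMoebius
open Summit.CriticalPhenomena.Ising3DConformalLimit.MoebiusLimitExistsNegative
open Summit.CriticalPhenomena.Ising3DConformalLimit.Theses.GaussianScaleMixture (RotationUpgradeFromTwoPoint)
open scoped Topology

variable {ρ : ℝ → ℝ} {Δ : ℝ} {S : CorrFamily 3}

/-- GKS I in infinite volume: `0 ≤ ⟨∏σ_{yᵢ}⟩⁺_{β_c}` on `ℤ³` (repetitions allowed).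
[cite: FriedliVelenik2017, Thm. 3.20, eq. (3.21), p. 109] -/
theorem criticalCorr_nonneg {n : ℕ} (y : Fin n → Site 3) : 0 ≤ criticalCorr 3 n y := by
  classical
  obtain ⟨A, hA⟩ := exists_spinMonomial_eq_spinProduct y
  show 0 ≤ plusExpect 3 (criticalBeta 3) 0 (spinMonomial y)
  rw [hA]
  exact plusCorr_nonneg (criticalBeta_nonneg 3) le_rfl A

/-- **Griffiths I passes to the limit**: under (H1)+(H2), `0 ≤ S n x` at every non-coincident
configuration. [cite: FriedliVelenik2017, Thm. 3.20] -/
theorem limit_nonneg (hρ : ∀ δ ∈ Set.Ioc (0:ℝ) 1, 0 < ρ δ)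
    (hlim : HasPointwiseScalingLimit (criticalCorr 3) ρ S) {n : ℕ}
    {x : Fin n → EuclideanSpace ℝ (Fin 3)} (hx : x ∈ NonCoincident 3 n) : 0 ≤ S n x := by
  refine ge_of_tendsto ((hlim n).tendsto_at hx) ?_
  have hmem : Set.Ioc (0:ℝ) 1 ∈ 𝓝[>] (0:ℝ) := Ioc_mem_nhdsGT one_pos
  filter_upwards [hmem] with δ hδ
  rw [rescaledCorrelator_apply]
  exact mul_nonneg (pow_nonneg (hρ δ hδ).le n) (criticalCorr_nonneg _)

/-- Transport of a zero of the two-point function: under (H5)+(H6)+(H7), if `S₂(0,v) = 0` for ONE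
`v ≠ 0` then `S₂(0,w) = 0` for EVERY `w ≠ 0` (dilate `v` to norm `‖w‖`, then reflect it onto `w`
with `Submodule.reflection_sub`). MODEL-BLIND. [folklore] -/
theorem two_kernel_eq_zero_of_zero (hsc : IsScaleCovariant Δ S)
    (hiso : ∀ (R : EuclideanSpace ℝ (Fin 3) ≃ₗᵢ[ℝ] EuclideanSpace ℝ (Fin 3)) (x : EuclideanSpace ℝ (Fin 3)),
      x ≠ 0 → S 2 ![0, R x] = S 2 ![0, x])
    {v : EuclideanSpace ℝ (Fin 3)} (hv : v ≠ 0) (h0 : S 2 ![0, v] = 0)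
    {w : EuclideanSpace ℝ (Fin 3)} (hw : w ≠ 0) : S 2 ![0, w] = 0 := by
  have hvn : 0 < ‖v‖ := norm_pos_iff.mpr hv
  have hwn : 0 < ‖w‖ := norm_pos_iff.mpr hw
  set c : ℝ := ‖w‖ / ‖v‖ with hc
  have hc0 : 0 < c := div_pos hwn hvn
  -- dilate
  have h1 : S 2 ![0, c • v] = 0 := by
    have h := hsc 2 c hc0 ![0, v]
    have hfun : (fun i => c • (![0, v] : Fin 2 → EuclideanSpace ℝ (Fin 3)) i) = ![0, c • v] := by
      funext i
      fin_cases i <;> simp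
    rw [hfun, h0, mul_zero] at h
    exact h
  -- reflect `c • v` onto `w`
  have hnorm : ‖c • v‖ = ‖w‖ := by
    rw [norm_smul, Real.norm_eq_abs, abs_of_pos hc0, hc, div_mul_cancel₀ _ hvn.ne']
  have hcv : c • v ≠ 0 := smul_ne_zero hc0.ne' hv
  have hR : Submodule.reflection (ℝ ∙ (c • v - w))ᗮ (c • v) = w := Submodule.reflection_sub hnorm
  rw [← hR, hiso _ (c • v) hcv, h1]

/-- A DEGENERATE instance of (H1)–(H3)+(H5)–(H7) has `S₂ ≡ 0`. [folklore] -/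
theorem two_eq_zero_of_degenerate (hρ : ∀ δ ∈ Set.Ioc (0:ℝ) 1, 0 < ρ δ)
    (hlim : HasPointwiseScalingLimit (criticalCorr 3) ρ S)
    (hnorm : ∀ n z, z ∉ NonCoincident 3 n → S n z = 0) (htr : IsTranslationInvariant S)
    (hsc : IsScaleCovariant Δ S)
    (hiso : ∀ (R : EuclideanSpace ℝ (Fin 3) ≃ₗᵢ[ℝ] EuclideanSpace ℝ (Fin 3)) (x : EuclideanSpace ℝ (Fin 3)),
      x ≠ 0 → S 2 ![0, R x] = S 2 ![0, x])
    (hdeg : ¬ IsNondegenerateTwoPoint S) (y : Fin 2 → EuclideanSpace ℝ (Fin 3)) : S 2 y = 0 := by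
  -- a non-coincident pair where `S₂ ≤ 0`, hence `= 0`
  obtain ⟨z, hz, hle⟩ : ∃ z ∈ NonCoincident 3 2, S 2 z ≤ 0 := by
    by_contra h
    push Not at h
    exact hdeg fun z hz => h z hz
  have hz0 : S 2 z = 0 := le_antisymm hle (limit_nonneg hρ hlim hz)
  have hzinj : z 0 ≠ z 1 := (injective_fin_two_iff z).1 ((mem_nonCoincident z).1 hz)
  have hzcfg : z = ![z 0, z 1] := by funext i; fin_cases i <;> rfl
  have hv : z 1 - z 0 ≠ 0 := sub_ne_zero.mpr hzinj.symm
  have hker : S 2 ![0, z 1 - z 0] = 0 := by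
    rw [← two_point_transl htr (z 0) (z 1), ← hzcfg, hz0]
  -- now any pair
  by_cases hy : y ∈ NonCoincident 3 2
  · have hyinj : y 0 ≠ y 1 := (injective_fin_two_iff y).1 ((mem_nonCoincident y).1 hy)
    have hycfg : y = ![y 0, y 1] := by funext i; fin_cases i <;> rfl
    rw [hycfg, two_point_transl htr (y 0) (y 1)]
    exact two_kernel_eq_zero_of_zero hsc hiso hv hker (sub_ne_zero.mpr hyinj.symm)
  · exact hnorm 2 y hy

/-- A Wick pairing sum of the zero kernel vanishes (`m ≥ 1`). [folklore] -/
theorem pairingSum_zero_kernel {m : ℕ} (hm : 1 ≤ m) (x : Fin (2 * m) → EuclideanSpace ℝ (Fin 3)) :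
    pairingSum (fun _ _ : EuclideanSpace ℝ (Fin 3) => (0:ℝ)) m x = 0 := by
  unfold pairingSum
  have hne : (Finset.univ : Finset (Fin m)).Nonempty := ⟨⟨0, hm⟩, Finset.mem_univ _⟩
  obtain ⟨j, hj⟩ := hne
  simp [Finset.prod_eq_zero hj]

/-- **A degenerate instance is trivial, hence rotation invariant.** Under (H1)–(H3)+(H5)–(H7) and
`¬ IsNondegenerateTwoPoint S`: `S₂ ≡ 0` (`two_eq_zero_of_degenerate`); `0 ≤ S₄ ≤ Σ S₂S₂ = 0` on
non-coincident quadruples (Griffiths I in the limit and tree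
`limitConnectedFour_nonpos_of_hasPointwiseScalingLimit`), so `U₄ ≡ 0` and every `S_{2m}`, `m ≥ 2`,
is a Wick sum of zeros (tree `HasPointwiseScalingLimit.eq_pairingSum_of_limitConnectedFour_eq_zero`);
odd orders vanish; `S₀` is untouched by rotations. [cite: AizenmanCDM2020, §7, Prop. 7.2] -/
theorem isRotationInvariant_of_degenerate (hρ : ∀ δ ∈ Set.Ioc (0:ℝ) 1, 0 < ρ δ)
    (hlim : HasPointwiseScalingLimit (criticalCorr 3) ρ S)
    (hnorm : ∀ n z, z ∉ NonCoincident 3 n → S n z = 0) (htr : IsTranslationInvariant S)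
    (hsc : IsScaleCovariant Δ S)
    (hiso : ∀ (R : EuclideanSpace ℝ (Fin 3) ≃ₗᵢ[ℝ] EuclideanSpace ℝ (Fin 3)) (x : EuclideanSpace ℝ (Fin 3)),
      x ≠ 0 → S 2 ![0, R x] = S 2 ![0, x])
    (hdeg : ¬ IsNondegenerateTwoPoint S) : IsRotationInvariant S := by
  have h2 : ∀ y, S 2 y = 0 := two_eq_zero_of_degenerate hρ hlim hnorm htr hsc hiso hdeg
  -- `S₄ ≡ 0` on non-coincident quadruples, hence `U₄ ≡ 0` there
  have hU : ∀ z ∈ NonCoincident 3 4, limitConnectedFour S z = 0 := by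
    intro z hz
    have hle := limitConnectedFour_nonpos_of_hasPointwiseScalingLimit (by norm_num) hlim hz
    have hge : 0 ≤ S 4 z := limit_nonneg hρ hlim hz
    simp only [limitConnectedFour, h2, mul_zero, add_zero, sub_zero] at hle ⊢
    exact le_antisymm hle hge
  -- all orders `≥ 1` vanish identically
  have hvan : ∀ n, 1 ≤ n → ∀ x, S n x = 0 := by
    intro n hn x
    rcases Nat.even_or_odd n with hev | hodd
    · obtain ⟨m, rfl⟩ : ∃ m, n = 2 * m := by
        obtain ⟨r, hr⟩ := hev
        exact ⟨r, by omega⟩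
      rcases Nat.lt_or_ge m 2 with hm | hm
      · interval_cases m
        · omega
        · exact h2 x
      · by_cases hx : x ∈ NonCoincident 3 (2 * m)
        · rw [hlim.eq_pairingSum_of_limitConnectedFour_eq_zero (by norm_num) hU hm hx]
          have hk : (fun p q : EuclideanSpace ℝ (Fin 3) => S 2 ![p, q]) = fun _ _ => (0:ℝ) := by
            funext p q; exact h2 _
          rw [hk]
          exact pairingSum_zero_kernel (by omega) x
        · exact hnorm _ x hx
    · exact InversionUpgradeNormalisedNegative.limit_odd_eq_zero hlim hnorm hodd x
  intro n R x
  rcases Nat.eq_zero_or_pos n with rfl | hn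
  · exact rot_zero S R x
  · rw [hvan n hn, hvan n hn]

/-- **REDUCTION 3: (H4) is NOT load-bearing.** The crux is equivalent to its version WITHOUT the
non-degeneracy hypothesis: degenerate instances are trivial and satisfy the conclusion. [folklore] -/
theorem crux_iff_withoutNondegeneracy :
    RotationUpgradeFromTwoPoint ↔
      ∀ (ρ : ℝ → ℝ) (Δ : ℝ) (S : CorrFamily 3), (∀ δ ∈ Set.Ioc (0:ℝ) 1, 0 < ρ δ) →
        HasPointwiseScalingLimit (criticalCorr 3) ρ S → (∀ n z, z ∉ NonCoincident 3 n → S n z = 0) →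
        IsTranslationInvariant S → IsScaleCovariant Δ S →
        (∀ (R : EuclideanSpace ℝ (Fin 3) ≃ₗᵢ[ℝ] EuclideanSpace ℝ (Fin 3)) (x : EuclideanSpace ℝ (Fin 3)),
          x ≠ 0 → S 2 ![0, R x] = S 2 ![0, x]) →
        IsRotationInvariant S := by
  constructor
  · intro h ρ Δ S h1 h2 h3 h5 h6 h7
    by_cases h4 : IsNondegenerateTwoPoint S
    · exact h ρ Δ S h1 h2 h3 h4 h5 h6 h7
    · exact isRotationInvariant_of_degenerate h1 h2 h3 h5 h6 h7 h4
  · intro h ρ Δ S h1 h2 h3 _ h5 h6 h7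
    exact h ρ Δ S h1 h2 h3 h5 h6 h7

/-- **REDUCTION 2+3 combined: the bare core.** The crux is equivalent to
"(H1) + (H2) + (H3) + (H7) ⇒ rotation invariance" for families that are scale covariant with SOME
exponent (which is automatic for non-degenerate limits by `scale_redundant`, and harmless to assume
in the degenerate case where the family is trivial): no `Δ`-binder content, no (H4), no (H5).
[folklore] -/
theorem crux_iff_bare :
    RotationUpgradeFromTwoPoint ↔
      ∀ (ρ : ℝ → ℝ) (S : CorrFamily 3), (∀ δ ∈ Set.Ioc (0:ℝ) 1, 0 < ρ δ) →
        HasPointwiseScalingLimit (criticalCorr 3) ρ S → (∀ n z, z ∉ NonCoincident 3 n → S n z = 0) →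
        (∃ Δ : ℝ, IsScaleCovariant Δ S) →
        (∀ (R : EuclideanSpace ℝ (Fin 3) ≃ₗᵢ[ℝ] EuclideanSpace ℝ (Fin 3)) (x : EuclideanSpace ℝ (Fin 3)),
          x ≠ 0 → S 2 ![0, R x] = S 2 ![0, x]) →
        IsRotationInvariant S := by
  rw [crux_iff_withoutNondegeneracy]
  constructor
  · intro h ρ S h1 h2 h3 ⟨Δ, h6⟩ h7
    exact h ρ Δ S h1 h2 h3 (translation_redundant h2 h3) h6 h7
  · intro h ρ Δ S h1 h2 h3 _ h6 h7
    exact h ρ S h1 h2 h3 ⟨Δ, h6⟩ h7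

end Summit.CriticalPhenomena.Ising3DConformalLimit.RotationUpgradeFromTwoPointNegative

end
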